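import Mathlib
import HarnessLib
import Summits.CriticalPhenomena.Ising3DConformalLimit.Theses.MirrorHoelderCompactness
import Summits.CriticalPhenomena.Ising3DConformalLimit.Theorems.MirrorHoelderCompactnessNineMirrorGradientMirror

/-!
# The nine-direction gradient estimate for the critical two-point function of the `ℤ³` Ising model
(route MirrorHoelderCompactness, support item `NineMirrorGradient`, stmt-CriticalPhenomena-6156)

For `G = ⟨σ₀σ_z⟩⁺_{β_c(3)}` (`criticalTwoPoint 3`), each of the nine lattice vectors
`u ∈ {e_i, e_i + e_j, e_i − e_j}` and every `z ∈ ℤ³` with `s := u·z ≥ 1`: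
`0 ≤ G(z) − G(z+u) ≤ (C/s)·g(⌊s/8⌋)`, `g(n) = G(n e₀)` (`nineMirrorGradient_proof`, literally the
route decl `NineMirrorGradient`, with `C = 4`).

## Proof

* Sign (`nine_sign`): Messager–Miracle-Solé (`messager_miracleSole_holds`,
  `messager_miracleSole_diag_holds`; the direction `e_i + e_j` after the coordinate reflection
  `x_j ↦ −x_j`, `twoPointPlus_reflection_invariant_holds`).
* Axis directions (`axis_gradient`): the tree's gradient estimate
  `twoPointFree_criticalBeta_gradient_estimate` (Duminil-Copin–Panis 2025 eq. (1.11); reflection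
  positivity through sites and bonds) with `j = ⌊s/8⌋`, `⟨·⟩^∅ = ⟨·⟩⁺` at `β_c` and axis symmetry.
* Diagonal directions (`anti_gradient`, `swap_gradient`): the mirror engine `mirror_gradient` of
  `MirrorHoelderCompactnessNineMirrorGradientMirror` on the anti-diagonal mirror
  `x_i ↦ −x_j, x_j ↦ −x_i` (level `x_i + x_j`, `u = e_i + e_j`) and the swap mirror `x_i ↔ x_j`
  (level `x_i − x_j`, `u = e_i − e_j`), both with `e = e_i`; their RP kernels are the second and
  third families of `criticalCorrNineMirrorRP_proof` (FILS 1978, Thm. 3.1), and the mirrors are the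
  signed permutations `(swap i j, ±)` (`antiMirror_eq_signedPerm`, `swapMirror_eq_signedPerm`),
  which leave `G` invariant (`twoPointPlus_signedPerm`).

References: M. Aizenman, H. Duminil-Copin, Ann. of Math. 194 (2021), §5.5 Prop. 5.9;
H. Duminil-Copin, R. Panis, CMP 406 (2025), eq. (1.11); J. Fröhlich, R. Israel, E. Lieb, B. Simon,
CMP 62 (1978) §2–3; A. Messager, S. Miracle-Solé, J. Stat. Phys. 17 (1977); G. Hegerfeldt, CMP 57
(1977). No definitions are introduced.
-/

noncomputable section

namespace Summit.CriticalPhenomena.Ising3DConformalLimit.MirrorHoelderNineMirrorGradient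

open Finset
open Literature.Probability.LatticeModels
open Summit.CriticalPhenomena.Ising3DConformalLimit.HyperoctahedralRPNineMirror

/-! ### E. The nine directions -/

/-- A level `x_i ± x_j` is at most twice the sup norm. [folklore] -/
theorem coord_le_supNorm (x : Site 3) (i : Fin 3) :
    x i ≤ (Site.supNorm x : ℤ) ∧ -x i ≤ (Site.supNorm x : ℤ) := by
  have h1 : ((x i).natAbs : ℤ) ≤ (Site.supNorm x : ℤ) := by
    exact_mod_cast Site.natAbs_le_supNorm x i
  constructor <;> omega

/-- **Anti-diagonal directions `u = e_i + e_j`** (`i ≠ j`): for `s := z_i + z_j ≥ 1`,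
`G(z) − G(z + e_i + e_j) ≤ (4/s) g(⌊s/8⌋)` — `mirror_gradient` for the anti-diagonal mirror
`x_i ↦ −x_j, x_j ↦ −x_i` (level `x_i + x_j`, `e = e_i`), whose RP kernel is the third family of
`criticalCorrNineMirrorRP_proof`. [cite: AizenmanDuminilCopinAnnals2021, arXiv:1912.07973 §5.5, proof of Prop. 5.9] -/
theorem anti_gradient {i j : Fin 3} (hij : i ≠ j) (z : Site 3) (hz : 1 ≤ z i + z j) :
    criticalTwoPoint 3 z - criticalTwoPoint 3 (z + (Pi.single i 1 + Pi.single j 1)) ≤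
      4 / ((z i + z j : ℤ) : ℝ) * criticalTwoPoint 3 (Pi.single 0 ((z i + z j) / 8)) := by
  set ε : Fin 3 → ℤˣ := fun l => if l = i ∨ l = j then -1 else 1 with hε
  set θ : Site 3 →+ Site 3 :=
    AddMonoidHom.mk' (Site.signedPerm (Equiv.swap i j) ε) (Site.signedPerm_add _ _) with hθ
  have hθap : ∀ x, θ x = Site.signedPerm (Equiv.swap i j) ε x := fun x => rfl
  have hθf : ∀ x : Site 3, θ x = Function.update (Function.update x i (-x j)) j (-x i) :=
    fun x => (congrFun (antiMirror_eq_signedPerm hij) x).symm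
  set ℓ : Site 3 →+ ℤ :=
    AddMonoidHom.mk' (fun x : Site 3 => x i + x j) (fun x y => by simp only [Pi.add_apply]; ring)
    with hℓ
  have hℓf : ∀ x, ℓ x = x i + x j := fun x => rfl
  have hεi : (ε i : ℤ) = -1 := by simp [hε]
  have hεj : (ε j : ℤ) = -1 := by simp [hε]
  have hθi : θ (Pi.single i 1) = -Pi.single j 1 := by
    rw [hθap, Site.signedPerm_single, Equiv.swap_apply_left, hεj, neg_smul, one_smul]
  have hθj : θ (Pi.single j 1) = -Pi.single i 1 := by
    rw [hθap, Site.signedPerm_single, Equiv.swap_apply_right, hεi, neg_smul, one_smul]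
  have hinv : Function.Involutive (Site.signedPerm (Equiv.swap i j) ε) := by
    have h := antiMirror_involutive (d := 3) hij
    rw [antiMirror_eq_signedPerm hij] at h
    exact h
  have key := mirror_gradient θ ℓ (Pi.single i 1 + Pi.single j 1) (Pi.single i 1)
    (fun m y c hy => by
      have h := rp_kernel _ _ ⟨i, j, hij, Or.inr (Or.inr ⟨rfl, rfl⟩)⟩ y c hy
      simp only [hθf]
      exact h)
    (by rw [map_add, hθi, hθj]; abel)
    (by rw [hθi]; abel)
    (by rw [hℓf]; simp [hij, hij.symm])
    (by rw [hℓf]; simp [hij.symm])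
    (fun x => by rw [hθap, hθap]; exact hinv x)
    (fun x => by rw [hθap]; exact crit_signedPerm _ _ x)
    (fun x => by
      rw [hℓf, hℓf, hθap]
      simp only [Site.signedPerm_apply, Equiv.symm_swap, Equiv.swap_apply_left,
        Equiv.swap_apply_right, hεi, hεj]
      ring)
    (fun x => by
      rw [hℓf]
      have h1 := (coord_le_supNorm x i).1
      have h2 := (coord_le_supNorm x j).1
      omega)
    z (by rw [hℓf]; exact hz)
  rw [hℓf] at key
  exact key

/-- **Diagonal directions `u = e_i − e_j`** (`i ≠ j`): for `s := z_i − z_j ≥ 1`,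
`G(z) − G(z + e_i − e_j) ≤ (4/s) g(⌊s/8⌋)` — `mirror_gradient` for the swap mirror `x_i ↔ x_j`
(level `x_i − x_j`, `e = e_i`), the second RP family of `criticalCorrNineMirrorRP_proof`.
[cite: AizenmanDuminilCopinAnnals2021, arXiv:1912.07973 §5.5, proof of Prop. 5.9] -/
theorem swap_gradient {i j : Fin 3} (hij : i ≠ j) (z : Site 3) (hz : 1 ≤ z i - z j) :
    criticalTwoPoint 3 z - criticalTwoPoint 3 (z + (Pi.single i 1 - Pi.single j 1)) ≤
      4 / ((z i - z j : ℤ) : ℝ) * criticalTwoPoint 3 (Pi.single 0 ((z i - z j) / 8)) := by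
  set θ : Site 3 →+ Site 3 :=
    AddMonoidHom.mk' (Site.signedPerm (Equiv.swap i j) 1) (Site.signedPerm_add _ _) with hθ
  have hθap : ∀ x, θ x = Site.signedPerm (Equiv.swap i j) 1 x := fun x => rfl
  have hθf : ∀ x : Site 3, θ x = x ∘ Equiv.swap i j :=
    fun x => (congrFun (swapMirror_eq_signedPerm (d := 3) i j) x).symm
  set ℓ : Site 3 →+ ℤ :=
    AddMonoidHom.mk' (fun x : Site 3 => x i - x j) (fun x y => by simp only [Pi.add_apply]; ring)
    with hℓ
  have hℓf : ∀ x, ℓ x = x i - x j := fun x => rfl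
  have hθi : θ (Pi.single i 1) = Pi.single j 1 := by
    rw [hθap, Site.signedPerm_single, Equiv.swap_apply_left]; simp
  have hθj : θ (Pi.single j 1) = Pi.single i 1 := by
    rw [hθap, Site.signedPerm_single, Equiv.swap_apply_right]; simp
  have hinv : Function.Involutive (Site.signedPerm (Equiv.swap i j) (1 : Fin 3 → ℤˣ)) := by
    have h := swapMirror_involutive (d := 3) i j
    rw [swapMirror_eq_signedPerm i j] at h
    exact h
  have key := mirror_gradient θ ℓ (Pi.single i 1 - Pi.single j 1) (Pi.single i 1)
    (fun m y c hy => by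
      have h := rp_kernel _ _ ⟨i, j, hij, Or.inr (Or.inl ⟨rfl, rfl⟩)⟩ y c hy
      simp only [hθf]
      exact h)
    (by rw [map_sub, hθi, hθj]; abel)
    (by rw [hθi]; abel)
    (by rw [hℓf]; simp [hij, hij.symm])
    (by rw [hℓf]; simp [hij.symm])
    (fun x => by rw [hθap, hθap]; exact hinv x)
    (fun x => by rw [hθap]; exact crit_signedPerm _ _ x)
    (fun x => by
      rw [hℓf, hℓf, hθf]
      simp only [Function.comp_apply, Equiv.swap_apply_left, Equiv.swap_apply_right]
      ring)
    (fun x => by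
      rw [hℓf]
      have h1 := (coord_le_supNorm x i).1
      have h2 := (coord_le_supNorm x j).2
      omega)
    z (by rw [hℓf]; exact hz)
  rw [hℓf] at key
  exact key

/-- **Axis directions `u = e_i`**: for `s := z_i ≥ 1`, `G(z) − G(z + e_i) ≤ (4/s) g(⌊s/8⌋)` — the
tree's gradient estimate `twoPointFree_criticalBeta_gradient_estimate` (Duminil-Copin–Panis 2025,
eq. (1.11)) with `j = ⌊s/8⌋`, `⟨·⟩^∅ = ⟨·⟩⁺` at `β_c` and axis symmetry. [cite: DuminilCopinPanis2025LowerBounds, eq. (1.11) and footnote 2] -/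
theorem axis_gradient (i : Fin 3) (z : Site 3) (hz : 1 ≤ z i) :
    criticalTwoPoint 3 z - criticalTwoPoint 3 (z + Pi.single i 1) ≤
      4 / ((z i : ℤ) : ℝ) * criticalTwoPoint 3 (Pi.single 0 (z i / 8)) := by
  obtain ⟨S, hS⟩ : ∃ S : ℕ, z i = S := ⟨(z i).toNat, (Int.toNat_of_nonneg (by omega)).symm⟩
  have hS1 : 1 ≤ S := by omega
  have hdiv : z i / 8 = ((S / 8 : ℕ) : ℤ) := by rw [hS]; push_cast; rfl
  rw [hdiv, hS]
  have h := twoPointFree_criticalBeta_gradient_estimate (d := 3) le_rfl i z (S / 8) (by omega)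
  rw [free_eq_crit, free_eq_crit, twoPointFree_single_eq_single (criticalBeta_nonneg 3) i 0,
    free_eq_crit, hS] at h
  have hSpos : (0 : ℝ) < S := by exact_mod_cast hS1
  have hden : (S : ℝ) ≤ 4 * ((S : ℝ) - (S / 8 : ℕ) + 1) := by
    have h1 : S + 4 * (S / 8) ≤ 4 * S + 4 := by omega
    have h2 : (S : ℝ) + 4 * ((S / 8 : ℕ) : ℝ) ≤ 4 * S + 4 := by exact_mod_cast h1
    linarith
  have hD : (0 : ℝ) < (S : ℝ) - (S / 8 : ℕ) + 1 := by linarith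
  set g : ℝ := criticalTwoPoint 3 (Pi.single 0 ((S / 8 : ℕ) : ℤ)) with hg
  have hg0 : 0 ≤ g := criticalTwoPoint_nonneg' _
  calc criticalTwoPoint 3 z - criticalTwoPoint 3 (z + Pi.single i 1)
        ≤ g / ((S : ℝ) - (S / 8 : ℕ) + 1) := by push_cast at h ⊢; exact h
    _ = (4 * g) / (4 * ((S : ℝ) - (S / 8 : ℕ) + 1)) := by
        rw [mul_div_mul_left _ _ (by norm_num : (4 : ℝ) ≠ 0)]
    _ ≤ (4 * g) / (S : ℝ) := div_le_div_of_nonneg_left (by linarith) hSpos hden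
    _ = 4 / ((S : ℤ) : ℝ) * g := by push_cast; ring

/-- **Messager–Miracle-Solé signs in the nine directions**: `G(z + u) ≤ G(z)` for `u·z ≥ 0`
(axis: `messager_miracleSole_holds`; `e_i − e_j`: `messager_miracleSole_diag_holds`; `e_i + e_j`:
the latter after the coordinate reflection `x_j ↦ −x_j`). [cite: MessagerMiracleSoleJSP1977, main theorem (monotonicity of ⟨σ₀σ_x⟩ under reflections)] -/
theorem nine_sign (u : Site 3)
    (hu : ∃ i j : Fin 3, i ≠ j ∧ (u = Pi.single i 1 ∨ u = Pi.single i 1 + Pi.single j 1 ∨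
      u = Pi.single i 1 - Pi.single j 1))
    (z : Site 3) (hz : 0 ≤ ∑ k, u k * z k) :
    criticalTwoPoint 3 (z + u) ≤ criticalTwoPoint 3 z := by
  have hβ := criticalBeta_nonneg 3
  obtain ⟨i, j, hij, rfl | rfl | rfl⟩ := hu
  · have hs : ∑ k, (Pi.single i (1 : ℤ) : Site 3) k * z k = z i := by
      simp [Pi.single_apply]
    rw [hs] at hz
    exact messager_miracleSole_holds hβ z i hz
  · have hs : ∑ k, (Pi.single i (1 : ℤ) + Pi.single j 1 : Site 3) k * z k = z i + z j := by
      simp [Pi.add_apply, add_mul, Finset.sum_add_distrib, Pi.single_apply]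
    rw [hs] at hz
    -- reflect the `j`-th coordinate
    have hR : ∀ x : Site 3, criticalTwoPoint 3 (Function.update x j (-x j)) = criticalTwoPoint 3 x :=
      fun x => twoPointPlus_reflection_invariant_holds hβ j x
    set z' : Site 3 := Function.update z j (-z j) with hz'
    have h1 : Function.update (z + (Pi.single i 1 + Pi.single j 1) : Site 3) j
        (-((z + (Pi.single i 1 + Pi.single j 1) : Site 3) j)) = z' + Pi.single i 1 - Pi.single j 1 := by
      ext k
      simp only [hz', Function.update_apply, Pi.add_apply, Pi.sub_apply, Pi.single_apply]
      by_cases hkj : k = j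
      · subst hkj; simp [hij.symm]; omega
      · simp [hkj]
    have h2 : z' j ≤ z' i := by
      simp only [hz', Function.update_self, Function.update_of_ne hij]
      omega
    rw [← hR (z + _), h1, ← hR z]
    exact messager_miracleSole_diag_holds hβ z' hij h2
  · have hs : ∑ k, (Pi.single i (1 : ℤ) - Pi.single j 1 : Site 3) k * z k = z i - z j := by
      simp [Pi.sub_apply, sub_mul, Finset.sum_sub_distrib, Pi.single_apply]
    rw [hs] at hz
    rw [← add_sub_assoc]
    exact messager_miracleSole_diag_holds hβ z hij (by omega)

/-! ### F. The route item -/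

open Summit.CriticalPhenomena.Ising3DConformalLimit.Theses.MirrorHoelderCompactness in
/-- **`NineMirrorGradient`** (item stmt-CriticalPhenomena-6156, L1 of card mirror-hoelder-modulus):
with `C = 4`, for each of the nine lattice vectors `u ∈ {e_i, e_i + e_j, e_i − e_j}` and every
`z ∈ ℤ³` with `s := u·z ≥ 1`, `0 ≤ G(z) − G(z+u) ≤ (C/s)·G(⌊s/8⌋ e₀)` for `G = criticalTwoPoint 3`:
sign by Messager–Miracle-Solé (`nine_sign`), size by reflection positivity in the mirrors normal
to `u` (`axis_gradient`, `anti_gradient`, `swap_gradient`). [cite: AizenmanDuminilCopinAnnals2021, arXiv:1912.07973 §5.5, Prop. 5.9] -/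
theorem nineMirrorGradient_proof : NineMirrorGradient := by
  refine ⟨4, fun u hu z hz => ⟨?_, ?_⟩⟩
  · have h := nine_sign u hu z (by omega)
    linarith
  obtain ⟨i, j, hij, rfl | rfl | rfl⟩ := hu
  · have hs : ∑ k, (Pi.single i (1 : ℤ) : Site 3) k * z k = z i := by
      simp [Pi.single_apply]
    rw [hs] at hz ⊢
    exact axis_gradient i z hz
  · have hs : ∑ k, (Pi.single i (1 : ℤ) + Pi.single j 1 : Site 3) k * z k = z i + z j := by
      simp [Pi.add_apply, add_mul, Finset.sum_add_distrib, Pi.single_apply]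
    rw [hs] at hz ⊢
    exact anti_gradient hij z hz
  · have hs : ∑ k, (Pi.single i (1 : ℤ) - Pi.single j 1 : Site 3) k * z k = z i - z j := by
      simp [Pi.sub_apply, sub_mul, Finset.sum_sub_distrib, Pi.single_apply]
    rw [hs] at hz ⊢
    exact swap_gradient hij z hz

end Summit.CriticalPhenomena.Ising3DConformalLimit.MirrorHoelderNineMirrorGradient

end
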